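import Mathlib
import Summits.CriticalPhenomena.SAWScalingLimit.Statement
import Literature.Probability.RandomPlanarGeometry.DiagonalDressedSAW
import HarnessLib

/-!
# Birth skeleton (BC3) of piece `CriticalCurve` of the split of `DiagonalUniversality`
(route `SAWDeterminantalDiagonal`, crux stmt-CriticalPhenomena-8247; crux-strategist BC2 redirect)

`CriticalCurve` is one of the three children CriticalCurve / WindowRigidity / ScoreDecoupling (statements in
`Cruxes/DiagonalUniversality/Split/SPLIT.md`; objects in
`Literature/Probability/RandomPlanarGeometry/DiagonalDressedSAW.lean`). Until the route split is applied
the piece is a LOCAL def here with the child's statement verbatim; afterwards replace `CriticalCurve` below by the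
route decl `Summit.CriticalPhenomena.SAWScalingLimit.Theses.SAWDeterminantalDiagonal.CriticalCurve` (same term).
Two named stubs (`sorry`, genuine lemmas of the line) and the kernel-checked composition `CriticalCurve_of`.
Checked: lean check rc 0, sorries = 2 = stubs; per-stub probes stub → CriticalCurve and stub → SAWScalingLimit
FAIL (bc/PROBES.md in the strategist folder, reproduced in SPLIT.md).
-/

noncomputable section

namespace Summit.CriticalPhenomena.SAWScalingLimit.Cruxes.DiagonalUniversality.Birth

open MeasureTheory Filter Topology Set
open scoped NNReal ENNReal BoundedContinuousFunction
open Literature.Probability.RandomPlanarGeometry Literature.Probability.LatticeModels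

namespace CriticalCurveBirth

/-- The child `CriticalCurve` of the split of `DiagonalUniversality` (verbatim statement of the route item to be). -/
def CriticalCurve : Prop :=
  ∃ ξ : ℝ → ℝ, Literature.Probability.RandomPlanarGeometry.SAW.IsDiagonalCriticalCurve ξ

/-! ## Birth skeleton of piece `CriticalCurve` (= `∃ ξ, SAW.IsDiagonalCriticalCurve ξ`)

Two stubs: pointwise existence of positive window-critical fugacities along `[0, 1/2]` anchored at
`x_c` (contains: the critical SAW itself is window-critical), and regularity (any such selection is
the trace on `[0, 1/2]` of a `C¹` positive curve — uniqueness + smoothness of the window curve). -/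

/-- Stub 1 — **window fugacities exist along the diagonal and start at `x_c`**: there is a selection
`s ↦ x_c(s)` of positive window-critical fugacities on `[0, 1/2]` with `x_c(0) = x_c` (the critical
SAW is window-critical: `|γ| ≫ δ⁻¹` and `|γ| ≪ δ⁻²` in probability). -/
theorem stub_windowFugacity_exists :
    ∃ xc : ℝ → ℝ, xc 0 = SAW.criticalFugacity ∧
      ∀ s ∈ Set.Icc (0 : ℝ) (1 / 2), 0 < xc s ∧ SAW.InDiagonalWindow s (xc s) := by
  sorry

/-- Stub 2 — **regularity of the window curve**: every selection of positive window-critical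
fugacities on `[0, 1/2]` is the restriction of a `C¹` positive curve on `ℝ` (uniqueness of the
window fugacity at each `s` plus `C¹` dependence on the dressing parameter, then any `C¹`
positive extension). -/
theorem stub_windowFugacity_regular :
    ∀ xc : ℝ → ℝ, (∀ s ∈ Set.Icc (0 : ℝ) (1 / 2), 0 < xc s ∧ SAW.InDiagonalWindow s (xc s)) →
      ∃ ξ : ℝ → ℝ, ContDiff ℝ 1 ξ ∧ (∀ s, 0 < ξ s) ∧ ∀ s ∈ Set.Icc (0 : ℝ) (1 / 2), ξ s = xc s := by
  sorry

/-- Composition: the two stubs give a critical curve (`IsDiagonalCriticalCurve`: `C¹`, positive,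
`ξ 0 = x_c`, window-critical on `[0, 1/2]`). -/
theorem CriticalCurve_of :
    (∃ xc : ℝ → ℝ, xc 0 = SAW.criticalFugacity ∧
      ∀ s ∈ Set.Icc (0 : ℝ) (1 / 2), 0 < xc s ∧ SAW.InDiagonalWindow s (xc s)) →
    (∀ xc : ℝ → ℝ, (∀ s ∈ Set.Icc (0 : ℝ) (1 / 2), 0 < xc s ∧ SAW.InDiagonalWindow s (xc s)) →
      ∃ ξ : ℝ → ℝ, ContDiff ℝ 1 ξ ∧ (∀ s, 0 < ξ s) ∧ ∀ s ∈ Set.Icc (0 : ℝ) (1 / 2), ξ s = xc s) →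
    CriticalCurve := by
  intro h1 h2
  obtain ⟨xc, h0, hw⟩ := h1
  obtain ⟨ξ, hξ, hpos, heq⟩ := h2 xc hw
  have h0mem : (0 : ℝ) ∈ Set.Icc (0 : ℝ) (1 / 2) := ⟨le_rfl, by norm_num⟩
  refine ⟨ξ, hξ, hpos, ?_, ?_⟩
  · rw [heq 0 h0mem, h0]
  · intro s hs
    rw [heq s hs]
    exact (hw s hs).2

end CriticalCurveBirth

end Summit.CriticalPhenomena.SAWScalingLimit.Cruxes.DiagonalUniversality.Birth
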